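import Literature.MathematicalPhysics.QuantumLattice.StackedHubbardLayersNoPairingBound
import Literature.MathematicalPhysics.QuantumLattice.FermionBogoliubovRowsMerminWagner
import HarnessLib

/-!
# The quasi-two-dimensional order-parameter bound for EVERY state with Bogoliubov rows — periodic (striped) equilibrium
# states included — and its explicit `1/log(1/ε_⊥)` form: an order parameter `m₀` of weakly coupled layers needs `β ≳ m₀² log(1/ε_⊥)`

Topic `Literature/MathematicalPhysics/QuantumLattice` (family `hubbard`; sequel of `LayeredEquilibriumStatesOrderParameterBound`,
`StackedHubbardLayersNoPairingBound`, `FermionBogoliubovRowsMerminWagner`).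

`LayeredEquilibriumStatesOrderParameterBound` proves Klein–Landau–Shucker's layered Mermin–Wagner bound
[cite: KleinLandauShucker1981] — the `U(1)` order parameter of a stack of two-dimensional layers with interlayer coupling `ε_⊥` is
`O(√(β/log(1/ε_⊥)))` — for translation-invariant solutions of the variational principle, because at the time that was the only
class of infinite-volume states SHOWN to obey Bogoliubov's inequality [cite: DLS1978, §2 eq. (28)]. The argument uses nothing
about the state except its Bogoliubov rows (`InfVolFermionState.HasBogoliubovRows`, `FermionBogoliubovRowsMerminWagner`), so it
holds verbatim for every state with the rows: in particular for every `q`-PERIODIC equilibrium state (striped / charge-ordered /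
pair-density-wave equilibrium states are periodic, not translation invariant; `IsPerVarEquilibrium.hasBogoliubovRows`) and for every
weak⋆ limit of such states along a pencil of interactions (infinitesimal-field states, `HasBogoliubovRows.of_tendsto_pencil`).
This file PROVES (standard axioms; no definition, no named fact):

* §1 `HasBogoliubovRows.norm_sq_expect_le_layered`: for a Hermitian-charge-conserving translation-covariant `Ψ` of range `R` on
  `ℤ³`, `β ≥ 0`, ANY state `ω` with the Bogoliubov rows of `Ψ` at `β`, `O ∈ 𝔄_Λ`, `Λ ⊆ box ρ₀`, of charge `κ`, `a ≥ ρ₀+3⌊R⌋+1`,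
  `M > 0`, `N ≥ a e^M`:
  `|κ|²|ω(O)|² ≤ β‖O‖² · 4‖q‖² |box ⌊R⌋| (2ρ₀+1) · [S_Ψ · 32⌊R⌋²(1 + log(N+ρ₀+⌊R⌋))/M² + ε_⊥(Ψ)(2N+1)²]`
  (`S_Ψ = Σ_{Z∋0}‖Φ(Z)‖`); the periodic-equilibrium form `IsPerVarEquilibrium.norm_sq_expect_le_layered` (every period `q`).
* §2 **the explicit law.** Choosing `e^{4M} = 1/ε` and `N = ⌈a e^M⌉` (real-analysis bookkeeping `layeredBracket_explicit_le`): for every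
  `ε` with `ε_⊥(Ψ) ≤ ε`, `0 < ε < 1`, `ℓ = log(1/ε)`:
  `|κ|²|ω(O)|² ≤ β‖O‖² · 4‖q‖² |box ⌊R⌋| (2ρ₀+1) · [S_Ψ ⌊R⌋² (128/ℓ + 512(1 + log 3a)/ℓ²) + 50 a²/ℓ]`
  (`HasBogoliubovRows.norm_sq_expect_le_layered_explicit`): the order parameter of weakly coupled layers is `O(√(β/log(1/ε_⊥)))`
  with explicit constants, for every state with Bogoliubov rows — an order parameter of size `m₀` forces `β ≳ m₀² log(1/ε_⊥)`,
  i.e. order of size `m₀` is possible only at temperatures `T ≲ 1/(m₀² log(1/ε_⊥))` (the rigorous content of the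
  quasi-two-dimensional estimate; this is NOT a bound `T_c → 0`: for `U(1)` layers the onset temperature may tend to the
  single-layer Kosterlitz–Thouless temperature, with an order parameter that vanishes as `ε_⊥ → 0`).
* §3 **the stacked `t–t'–t_⊥` Hubbard model** (`stackedHubbardInteraction`, `ε_⊥ ≤ 4|t_⊥|`): the bracket form
  `HasBogoliubovRows.norm_sq_expect_le_stacked`, the pairing-amplitude form `….norm_sq_expect_pair_le_stacked`
  (`4|ω(c_p c_q)|² ≤ β · …`), their PERIODIC-EQUILIBRIUM forms (`IsPerVarEquilibrium.norm_sq_expect_pair_le_stacked`: the pairing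
  amplitude of every striped / periodic equilibrium state of weakly coupled Hubbard layers obeys the same `β ≳ m₀² log(1/|t_⊥|)`
  law as the homogeneous ones), and the explicit law `HasBogoliubovRows.norm_sq_expect_pair_le_stacked_explicit`:
  for `0 < 4|t_⊥| < 1`, `ℓ = log(1/(4|t_⊥|))`, `a = ρ₀ + 4`,
  `4|ω(c_p c_q)|² ≤ β · 16 · 27(2ρ₀+1) · [S_Ψ (128/ℓ + 512(1 + log 3a)/ℓ²) + 50a²/ℓ]` (`‖q‖ = ‖n_↑+n_↓‖ ≤ 2`).

WHAT THIS IS NOT: this is an upper bound (ceiling) on order parameters at given `β` — equivalently an upper bound on the temperature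
at which an order parameter OF A GIVEN SIZE can exist — not a bound on a critical temperature (the size of the order parameter near
onset is not controlled from below); nothing here asserts order at any temperature; the identification KMS ⟹ rows is proved in the tree class by class (variational, periodic,
torus-limit Gibbs, their pencil limits), not for abstract KMS states.

## Mathlib / tree search

`lean search 'norm_sq_expect_le_layered|norm_sq_expect_le_stacked|interlayerNorm'` (2026-08-29): only the translation-invariant
/ `IsVarEquilibrium` forms (`LayeredEquilibriumStatesOrderParameterBound`, `StackedHubbardLayersNoPairingBound`). REUSED verbatim:
`FermionInteraction.sum_layeredCutoff_le`, `layeredCutoff`, `logCutoff_eq_one/zero`, `thicken_box_subset`, `interlayerNorm_stacked_le`,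
`commute_chargeSum_numberCharge_stacked`, `stackedHubbardInteraction_is*`, `HasBogoliubovRows.norm_sq_expect_le_of_conservedCharge`,
`IsPerVarEquilibrium.hasBogoliubovRows`, `totalNumber_commutator_annihilation_mul_annihilation`, `norm_annihilation_le_one`,
`norm_numberCharge_le`-type facts proved inline.

## References

* A. Klein, L. J. Landau, D. S. Shucker, *On the absence of spontaneous breakdown of continuous symmetry for equilibrium states in two
  dimensions*, J. Stat. Phys. 26 (1981) 505–512 (every KMS state; Bogoliubov inequality + cutoff). [cite: KleinLandauShucker1981]
* F. J. Dyson, E. H. Lieb, B. Simon, J. Stat. Phys. 18 (1978) 335, §2 eq. (28) (Bogoliubov's inequality). [cite: DLS1978, §2 eq. (28)]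
* T. Koma, H. Tasaki, Phys. Rev. Lett. 68 (1992) 3248 (no pairing / planar magnetic order in low-dimensional Hubbard models at
  `T > 0`; the bond norm). [cite: KomaTasakiPRL1992, p. 3]
* R. B. Israel, *Convexity in the theory of lattice gases* (1979), Thm. I.2.4 (periodic variational states). [cite: Israel1979, Thm. I.2.4]
* H. Araki, H. Moriya, Rev. Math. Phys. 15 (2003) 93, Thm. 12.11. [cite: ArakiMoriya2003, Theorem 12.11]
-/

noncomputable section

open scoped ComplexOrder BigOperators Matrix.Norms.L2Operator
open Finset Literature.InformationTheory.Entropy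

namespace Literature.MathematicalPhysics.QuantumLattice

open Matrix Literature.Probability.LatticeModels ThermodynamicLimit LiebThm1 HubbardWave0
open _root_.Filter
open scoped _root_.Topology

/-! ### §1 The layered bound for every state with Bogoliubov rows -/

section Layered

variable {Ψ : FermionInteraction 3} {R : ℝ} (hT : Ψ.IsTranslationInvariant) (hR : Ψ.HasFiniteRange R) {β : ℝ} (hβ : 0 ≤ β)
  {ω : InfVolFermionState 3}
include hT hR hβ

/-- **THE ORDER PARAMETER OF A LAYERED MODEL IS CONTROLLED BY THE INTERLAYER COUPLING — FOR EVERY STATE WITH BOGOLIUBOV ROWS.**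
Let `Ψ` be a translation-covariant interaction of finite range `R` on `ℤ³` each of whose terms conserves the even Hermitian on-site
charge `q`; let `β ≥ 0` and `ω` ANY state with the Bogoliubov rows of `Ψ` at `β` (translation invariant or not, periodic or not),
`O ∈ 𝔄_Λ` with `Λ ⊆ box ρ₀` and `Q_Λ O − O Q_Λ = κO`. Then for every in-plane radius `a ≥ ρ₀ + 3⌊R⌋ + 1`, every scale `M > 0` and
every `N ≥ a e^M`:
`|κ|²|ω(O)|² ≤ β‖O‖² · 4‖q‖² · |box ⌊R⌋| (2ρ₀+1) · [S_Ψ · 32⌊R⌋²(1 + log(N + ρ₀ + ⌊R⌋))/M² + ε_⊥(Ψ) · (2N+1)²]`.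
[cite: KleinLandauShucker1981] [cite: DLS1978, §2 eq. (28)] -/
theorem InfVolFermionState.HasBogoliubovRows.norm_sq_expect_le_layered (h : ω.HasBogoliubovRows Ψ R β)
    {q : FermionOp ({0} : Finset (Site 3))} (hq : q.IsHermitian) (hqe : parityAut q = q)
    (hcons : ∀ Z : Finset (Site 3), Commute (chargeSum q Z) (Ψ.Φ Z))
    {Λ : Finset (Site 3)} {ρ₀ : ℕ} (hΛ : Λ ⊆ box 3 ρ₀) (O : FermionOp Λ) {κ : ℂ} (hO : chargeSum q Λ * O - O * chargeSum q Λ = κ • O)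
    {a N : ℕ} (ha : ρ₀ + 3 * ⌊R⌋₊ + 1 ≤ a) {M : ℝ} (hM : 0 < M) (haN : (a : ℝ) * Real.exp M ≤ N) :
    ‖κ‖ ^ 2 * ‖ω.expect Λ O‖ ^ 2 ≤ β * ‖O‖ ^ 2 * (4 * ‖q‖ ^ 2 * (((box 3 ⌊R⌋₊).card : ℝ) * (2 * ρ₀ + 1) *
      ((∑ X ∈ (thicken ({0} : Finset (Site 3)) R).powerset with (0 : Site 3) ∈ X, ‖Ψ.Φ X‖) *
          (32 * (⌊R⌋₊ : ℝ) ^ 2 * (1 + Real.log ((N + ρ₀ + ⌊R⌋₊ : ℕ) : ℝ)) / M ^ 2) +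
        Ψ.interlayerNorm R * (2 * (N : ℝ) + 1) ^ 2))) := by
  classical
  have ha1 : 1 ≤ a := by omega
  have har : 3 * ⌊R⌋₊ ≤ a := by omega
  have hS' : ∀ x ∈ thicken (box 3 (N + ρ₀)) R, Site.supNorm x ≤ N + ρ₀ + ⌊R⌋₊ := fun x hx =>
    mem_box_iff_supNorm_le.1 (thicken_box_subset (N + ρ₀) R hx)
  obtain ⟨c, hc⟩ := Ψ.sum_layeredCutoff_le hT hR (ρ₀ := ρ₀) ha1 har hM haN _ hS'
  have h₁ : Λ ⊆ box 3 (N + ρ₀) := hΛ.trans (box_mono 3 (by omega))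
  -- `f ≡ 1` on `Λ`
  have hf1 : ∀ x ∈ Λ, layeredCutoff a ρ₀ M x = 1 := by
    intro x hx
    have hxρ : Site.supNorm x ≤ ρ₀ := mem_box_iff_supNorm_le.1 (hΛ hx)
    unfold layeredCutoff
    rw [if_pos ((natAbs_apply_two_le x).trans hxρ)]
    exact logCutoff_eq_one ha1 hM ((supNorm_planeOf_le x).trans (hxρ.trans (by omega)))
  -- `f ≡ 0` off `box (N + ρ₀)`
  have hf0 : ∀ x ∉ box 3 (N + ρ₀), layeredCutoff a ρ₀ M x = 0 := by
    intro x hx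
    rw [mem_box_iff_supNorm_le, not_le] at hx
    unfold layeredCutoff
    split_ifs with hh
    · refine logCutoff_eq_zero ha1 hM (haN.trans ?_)
      have hmax := supNorm_le_max_planeOf x
      have : N < Site.supNorm (planeOf x) := by
        rcases le_max_iff.1 hmax with h' | h'
        · omega
        · omega
      exact_mod_cast this.le
    · rfl
  have hmain := h.norm_sq_expect_le_of_conservedCharge hβ hq hqe hcons O hO h₁ hf1 hf0 c
  refine hmain.trans (mul_le_mul_of_nonneg_left (mul_le_mul_of_nonneg_left ?_ (by positivity)) (by positivity))
  exact_mod_cast hc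

/-- **Periodic-equilibrium form of the layered bound**: every `q`-periodic solution of the variational principle (striped,
charge-ordered or pair-density-wave equilibrium states are of this kind) of a Hermitian, even, translation-covariant finite-range
interaction on `ℤ³` obeys the layered Mermin–Wagner bound. [cite: KleinLandauShucker1981] [cite: Israel1979, Thm. I.2.4] -/
theorem InfVolFermionState.IsPerVarEquilibrium.norm_sq_expect_le_layered (hH : Ψ.IsHermitian) (hE : Ψ.IsEven) {p : Fin 3 → ℕ}
    (h : ω.IsPerVarEquilibrium β p Ψ R)
    {q : FermionOp ({0} : Finset (Site 3))} (hq : q.IsHermitian) (hqe : parityAut q = q)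
    (hcons : ∀ Z : Finset (Site 3), Commute (chargeSum q Z) (Ψ.Φ Z))
    {Λ : Finset (Site 3)} {ρ₀ : ℕ} (hΛ : Λ ⊆ box 3 ρ₀) (O : FermionOp Λ) {κ : ℂ} (hO : chargeSum q Λ * O - O * chargeSum q Λ = κ • O)
    {a N : ℕ} (ha : ρ₀ + 3 * ⌊R⌋₊ + 1 ≤ a) {M : ℝ} (hM : 0 < M) (haN : (a : ℝ) * Real.exp M ≤ N) :
    ‖κ‖ ^ 2 * ‖ω.expect Λ O‖ ^ 2 ≤ β * ‖O‖ ^ 2 * (4 * ‖q‖ ^ 2 * (((box 3 ⌊R⌋₊).card : ℝ) * (2 * ρ₀ + 1) *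
      ((∑ X ∈ (thicken ({0} : Finset (Site 3)) R).powerset with (0 : Site 3) ∈ X, ‖Ψ.Φ X‖) *
          (32 * (⌊R⌋₊ : ℝ) ^ 2 * (1 + Real.log ((N + ρ₀ + ⌊R⌋₊ : ℕ) : ℝ)) / M ^ 2) +
        Ψ.interlayerNorm R * (2 * (N : ℝ) + 1) ^ 2))) :=
  (h.hasBogoliubovRows (by norm_num) hH hE hT hR hβ).norm_sq_expect_le_layered hT hR hβ hq hqe hcons hΛ O hO ha hM haN

end Layered

/-! ### §2 The explicit `1/log(1/ε)` law: choosing the scale `e^{4M} = 1/ε`, `N = ⌈a e^M⌉` -/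

section Explicit

/-- `√x · log(1/x) ≤ 2` for `x > 0` (from `log y ≤ 2 y^{1/2}`): the interlayer term `ε e^{2M} = √ε` at the scale `e^{4M} = 1/ε`
is `≤ 2/log(1/ε)`. [cite: KleinLandauShucker1981] -/
theorem sqrt_mul_log_one_div_le_two {x : ℝ} (hx : 0 < x) : Real.sqrt x * Real.log (1 / x) ≤ 2 := by
  have h1 : Real.log x⁻¹ ≤ x⁻¹ ^ (1 / 2 : ℝ) / (1 / 2 : ℝ) := Real.log_le_rpow_div (inv_nonneg.2 hx.le) (by norm_num)
  have h2 : x⁻¹ ^ (1 / 2 : ℝ) = (Real.sqrt x)⁻¹ := by rw [Real.inv_rpow hx.le, ← Real.sqrt_eq_rpow]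
  rw [h2] at h1
  rw [one_div x]
  have hs : 0 < Real.sqrt x := Real.sqrt_pos.2 hx
  have hss : Real.sqrt x * (Real.sqrt x)⁻¹ = 1 := mul_inv_cancel₀ hs.ne'
  calc Real.sqrt x * Real.log x⁻¹ ≤ Real.sqrt x * ((Real.sqrt x)⁻¹ / (1 / 2 : ℝ)) := mul_le_mul_of_nonneg_left h1 hs.le
    _ = Real.sqrt x * (Real.sqrt x)⁻¹ * 2 := by ring
    _ = 2 := by rw [hss, one_mul]

/-- **THE SCALE CHOICE.** For `0 < ε < 1`, `ℓ = log(1/ε)`, `M = ℓ/4`, integers `1 ≤ a`, `r`, `ρ₀` with `ρ₀ + 2 ≤ a` (and any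
`r ≤ a`), `N = ⌈a e^M⌉`, `S ≥ 0` and `E ≤ ε`:
`S · 32 r² (1 + log(N + ρ₀ + r))/M² + E (2N+1)² ≤ S · r² · (128/ℓ + 512 (1 + log 3a)/ℓ²) + 50 a²/ℓ`
(`N ≤ a e^M + 1`, `N + ρ₀ + r ≤ 3a e^M`, `(2N+1)² ≤ 25a² e^{2M}`, `ε e^{2M} = √ε ≤ 2/ℓ`; nonnegative `S`, any real `E ≤ ε`). [cite: KleinLandauShucker1981] -/
theorem layeredBracket_explicit_le {ε S E : ℝ} (hε0 : 0 < ε) (hε1 : ε < 1) (hS : 0 ≤ S) (hE : E ≤ ε)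
    {a r ρ₀ : ℕ} (ha : 1 ≤ a) (hρa : ρ₀ + 2 ≤ a) (hra : r ≤ a) :
    S * (32 * (r : ℝ) ^ 2 * (1 + Real.log ((⌈(a : ℝ) * Real.exp (Real.log (1 / ε) / 4)⌉₊ + ρ₀ + r : ℕ) : ℝ)) /
        (Real.log (1 / ε) / 4) ^ 2) +
      E * (2 * (⌈(a : ℝ) * Real.exp (Real.log (1 / ε) / 4)⌉₊ : ℝ) + 1) ^ 2 ≤
      S * (r : ℝ) ^ 2 * (128 / Real.log (1 / ε) + 512 * (1 + Real.log (3 * a)) / Real.log (1 / ε) ^ 2) +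
        50 * (a : ℝ) ^ 2 / Real.log (1 / ε) := by
  set ℓ : ℝ := Real.log (1 / ε) with hℓ
  have hℓ0 : 0 < ℓ := Real.log_pos (by rw [lt_div_iff₀ hε0, one_mul]; exact hε1)
  set M : ℝ := ℓ / 4 with hM
  have hM0 : 0 < M := by positivity
  set N : ℕ := ⌈(a : ℝ) * Real.exp M⌉₊ with hN
  have ha0 : (1 : ℝ) ≤ a := by exact_mod_cast ha
  have heM : 1 ≤ Real.exp M := Real.one_le_exp hM0.le
  have haeM : (a : ℝ) ≤ a * Real.exp M := le_mul_of_one_le_right (by positivity) heM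
  -- `N ≤ a e^M + 1`
  have hN1 : (N : ℝ) ≤ a * Real.exp M + 1 := (Nat.ceil_lt_add_one (by positivity)).le
  -- `(2N+1)² ≤ 25 a² e^{2M}`
  have hsq : (2 * (N : ℝ) + 1) ^ 2 ≤ 25 * (a : ℝ) ^ 2 * Real.exp M ^ 2 := by
    have h1 : 2 * (N : ℝ) + 1 ≤ 5 * (a * Real.exp M) := by nlinarith
    have h2 : 0 ≤ 2 * (N : ℝ) + 1 := by positivity
    calc (2 * (N : ℝ) + 1) ^ 2 ≤ (5 * (a * Real.exp M)) ^ 2 := pow_le_pow_left₀ h2 h1 2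
      _ = 25 * (a : ℝ) ^ 2 * Real.exp M ^ 2 := by ring
  -- `e^{4M} = 1/ε`, so `ε e^{2M} = √ε`
  have hx4 : Real.exp M ^ 2 * Real.exp M ^ 2 = 1 / ε := by
    rw [← pow_add, ← Real.exp_nat_mul]
    have : ((2 + 2 : ℕ) : ℝ) * M = Real.log (1 / ε) := by push_cast; rw [hM, hℓ]; ring
    rw [this, Real.exp_log (by positivity)]
  have hsqrt : ε * Real.exp M ^ 2 = Real.sqrt ε := by
    rw [eq_comm, Real.sqrt_eq_iff_mul_self_eq hε0.le (by positivity)]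
    have : ε * Real.exp M ^ 2 * (ε * Real.exp M ^ 2) = ε * ε * (Real.exp M ^ 2 * Real.exp M ^ 2) := by ring
    rw [this, hx4]
    field_simp
  have hEterm : E * (2 * (N : ℝ) + 1) ^ 2 ≤ 50 * (a : ℝ) ^ 2 / ℓ := by
    have hsε : 0 < Real.sqrt ε := Real.sqrt_pos.2 hε0
    have h1 : E * (2 * (N : ℝ) + 1) ^ 2 ≤ ε * (25 * (a : ℝ) ^ 2 * Real.exp M ^ 2) :=
      mul_le_mul hE hsq (by positivity) hε0.le
    have h2 : ε * (25 * (a : ℝ) ^ 2 * Real.exp M ^ 2) = 25 * (a : ℝ) ^ 2 * Real.sqrt ε := by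
      rw [← hsqrt]; ring
    have h3 : Real.sqrt ε ≤ 2 / ℓ := by
      rw [le_div_iff₀ hℓ0]
      exact sqrt_mul_log_one_div_le_two hε0
    calc E * (2 * (N : ℝ) + 1) ^ 2 ≤ 25 * (a : ℝ) ^ 2 * Real.sqrt ε := h1.trans h2.le
      _ ≤ 25 * (a : ℝ) ^ 2 * (2 / ℓ) := mul_le_mul_of_nonneg_left h3 (by positivity)
      _ = 50 * (a : ℝ) ^ 2 / ℓ := by ring
  -- `log(N + ρ₀ + r) ≤ log(3a) + M`
  have hlog : Real.log ((N + ρ₀ + r : ℕ) : ℝ) ≤ Real.log (3 * a) + M := by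
    have hpos : (0 : ℝ) < (N + ρ₀ + r : ℕ) := by
      have : 1 ≤ N + ρ₀ + r := by
        have : 1 ≤ N := Nat.one_le_iff_ne_zero.2 (Nat.pos_iff_ne_zero.1 (Nat.ceil_pos.2 (by positivity)))
        omega
      exact_mod_cast this
    have hle : ((N + ρ₀ + r : ℕ) : ℝ) ≤ 3 * a * Real.exp M := by
      push_cast
      have hρ : (ρ₀ : ℝ) + 2 ≤ a := by exact_mod_cast hρa
      have hr : (r : ℝ) ≤ a := by exact_mod_cast hra
      nlinarith
    calc Real.log ((N + ρ₀ + r : ℕ) : ℝ) ≤ Real.log (3 * a * Real.exp M) := Real.log_le_log hpos hle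
      _ = Real.log (3 * a) + M := by rw [Real.log_mul (by positivity) (Real.exp_pos M).ne', Real.log_exp]
  have hSterm : S * (32 * (r : ℝ) ^ 2 * (1 + Real.log ((N + ρ₀ + r : ℕ) : ℝ)) / M ^ 2) ≤
      S * (r : ℝ) ^ 2 * (128 / ℓ + 512 * (1 + Real.log (3 * a)) / ℓ ^ 2) := by
    have hlog3a : 0 ≤ Real.log (3 * a) := Real.log_nonneg (by linarith)
    have h1 : 1 + Real.log ((N + ρ₀ + r : ℕ) : ℝ) ≤ (1 + Real.log (3 * a)) + M := by linarith
    have h0 : 0 ≤ 1 + Real.log ((N + ρ₀ + r : ℕ) : ℝ) := by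
      refine add_nonneg zero_le_one (Real.log_nonneg ?_)
      have : 1 ≤ N + ρ₀ + r := by
        have : 1 ≤ N := Nat.one_le_iff_ne_zero.2 (Nat.pos_iff_ne_zero.1 (Nat.ceil_pos.2 (by positivity)))
        omega
      exact_mod_cast this
    have h2 : 32 * (r : ℝ) ^ 2 * (1 + Real.log ((N + ρ₀ + r : ℕ) : ℝ)) / M ^ 2 ≤
        32 * (r : ℝ) ^ 2 * ((1 + Real.log (3 * a)) + M) / M ^ 2 :=
      div_le_div_of_nonneg_right (mul_le_mul_of_nonneg_left h1 (by positivity)) (by positivity)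
    have h3 : 32 * (r : ℝ) ^ 2 * ((1 + Real.log (3 * a)) + M) / M ^ 2 =
        (r : ℝ) ^ 2 * (128 / ℓ + 512 * (1 + Real.log (3 * a)) / ℓ ^ 2) := by
      rw [hM]
      field_simp
      ring
    calc S * (32 * (r : ℝ) ^ 2 * (1 + Real.log ((N + ρ₀ + r : ℕ) : ℝ)) / M ^ 2)
        ≤ S * (32 * (r : ℝ) ^ 2 * ((1 + Real.log (3 * a)) + M) / M ^ 2) := mul_le_mul_of_nonneg_left h2 hS
      _ = S * (r : ℝ) ^ 2 * (128 / ℓ + 512 * (1 + Real.log (3 * a)) / ℓ ^ 2) := by rw [h3, mul_assoc]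
  exact add_le_add hSterm hEterm

variable {Ψ : FermionInteraction 3} {R : ℝ} (hT : Ψ.IsTranslationInvariant) (hR : Ψ.HasFiniteRange R) {β : ℝ} (hβ : 0 ≤ β)
  {ω : InfVolFermionState 3}
include hT hR hβ

/-- **THE EXPLICIT QUASI-TWO-DIMENSIONAL LAW FOR EVERY STATE WITH BOGOLIUBOV ROWS.** With the data of
`HasBogoliubovRows.norm_sq_expect_le_layered`, every `ε` with `ε_⊥(Ψ) ≤ ε`, `0 < ε < 1`, `ℓ = log(1/ε)` and `a = ρ₀ + 3⌊R⌋ + 2`: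
`|κ|²|ω(O)|² ≤ β‖O‖² · 4‖q‖² |box ⌊R⌋| (2ρ₀+1) · [S_Ψ ⌊R⌋² (128/ℓ + 512(1 + log 3a)/ℓ²) + 50a²/ℓ]` — the order parameter of weakly
coupled layers is `O(√(β / log(1/ε_⊥)))`, so an order parameter of size `m₀` needs `β ≳ m₀² log(1/ε_⊥)`: order of size `m₀` lives
only at temperatures `O(1/(m₀² log(1/ε_⊥)))`. [cite: KleinLandauShucker1981] [cite: DLS1978, §2 eq. (28)] -/
theorem InfVolFermionState.HasBogoliubovRows.norm_sq_expect_le_layered_explicit (h : ω.HasBogoliubovRows Ψ R β)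
    {q : FermionOp ({0} : Finset (Site 3))} (hq : q.IsHermitian) (hqe : parityAut q = q)
    (hcons : ∀ Z : Finset (Site 3), Commute (chargeSum q Z) (Ψ.Φ Z))
    {Λ : Finset (Site 3)} {ρ₀ : ℕ} (hΛ : Λ ⊆ box 3 ρ₀) (O : FermionOp Λ) {κ : ℂ} (hO : chargeSum q Λ * O - O * chargeSum q Λ = κ • O)
    {ε : ℝ} (hε : Ψ.interlayerNorm R ≤ ε) (hε0 : 0 < ε) (hε1 : ε < 1) :
    ‖κ‖ ^ 2 * ‖ω.expect Λ O‖ ^ 2 ≤ β * ‖O‖ ^ 2 * (4 * ‖q‖ ^ 2 * (((box 3 ⌊R⌋₊).card : ℝ) * (2 * ρ₀ + 1) *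
      ((∑ X ∈ (thicken ({0} : Finset (Site 3)) R).powerset with (0 : Site 3) ∈ X, ‖Ψ.Φ X‖) * (⌊R⌋₊ : ℝ) ^ 2 *
          (128 / Real.log (1 / ε) + 512 * (1 + Real.log (3 * (ρ₀ + 3 * ⌊R⌋₊ + 2 : ℕ))) / Real.log (1 / ε) ^ 2) +
        50 * ((ρ₀ + 3 * ⌊R⌋₊ + 2 : ℕ) : ℝ) ^ 2 / Real.log (1 / ε)))) := by
  set a : ℕ := ρ₀ + 3 * ⌊R⌋₊ + 2 with ha_def
  have hℓ0 : 0 < Real.log (1 / ε) := Real.log_pos (by rw [lt_div_iff₀ hε0, one_mul]; exact hε1)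
  have hM : 0 < Real.log (1 / ε) / 4 := by positivity
  have hmain := h.norm_sq_expect_le_layered hT hR hβ hq hqe hcons hΛ O hO (a := a)
    (N := ⌈(a : ℝ) * Real.exp (Real.log (1 / ε) / 4)⌉₊) (by omega) hM (Nat.le_ceil _)
  have hS0 : 0 ≤ ∑ X ∈ (thicken ({0} : Finset (Site 3)) R).powerset with (0 : Site 3) ∈ X, ‖Ψ.Φ X‖ :=
    Finset.sum_nonneg fun _ _ => norm_nonneg _
  have hbr := layeredBracket_explicit_le hε0 hε1 hS0 hε (a := a) (r := ⌊R⌋₊) (ρ₀ := ρ₀)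
    (by omega) (by omega) (by omega)
  refine hmain.trans ?_
  have hρ : (0 : ℝ) ≤ 2 * ρ₀ + 1 := by positivity
  have hc : (0 : ℝ) ≤ ((box 3 ⌊R⌋₊).card : ℝ) := Nat.cast_nonneg _
  have := mul_le_mul_of_nonneg_left (mul_le_mul_of_nonneg_left hbr (mul_nonneg hc hρ)) (by positivity : (0 : ℝ) ≤ 4 * ‖q‖ ^ 2)
  have := mul_le_mul_of_nonneg_left this (by positivity : (0 : ℝ) ≤ β * ‖O‖ ^ 2)
  refine this.trans (le_of_eq ?_)
  ring

end Explicit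

/-! ### §3 The stacked `t–t'–t_⊥` Hubbard model -/

section Stacked

variable (t t' tp U μ : ℝ) {β : ℝ} (hβ : 0 ≤ β) {ω : InfVolFermionState 3}
include hβ

/-- **ORDER-PARAMETER BOUND FOR THE STACKED HUBBARD MODEL, any state with Bogoliubov rows.** For every `β ≥ 0`, every state `ω`
with the Bogoliubov rows of the stacked `t–t'–t_⊥` Hubbard interaction (range `1`) at `β`, every local `O ∈ 𝔄_Λ`, `Λ ⊆ box ρ₀`, with
`N_Λ O − O N_Λ = κ O`, every `a ≥ ρ₀ + 4`, `M > 0` and `N ≥ a e^M`: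
`|κ|²|ω(O)|² ≤ β‖O‖² · 4‖q‖² · 27(2ρ₀+1) · [S_Ψ · 32(1 + log(N + ρ₀ + 1))/M² + 4|t_⊥| (2N+1)²]`.
[cite: KleinLandauShucker1981] [cite: KomaTasakiPRL1992, p. 3] -/
theorem InfVolFermionState.HasBogoliubovRows.norm_sq_expect_le_stacked
    (h : ω.HasBogoliubovRows (stackedHubbardInteraction t t' tp U μ) 1 β)
    {Λ : Finset (Site 3)} {ρ₀ : ℕ} (hΛ : Λ ⊆ box 3 ρ₀) (O : FermionOp Λ) {κ : ℂ}
    (hO : (totalNumber : FermionOp Λ) * O - O * totalNumber = κ • O)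
    {a N : ℕ} (ha : ρ₀ + 4 ≤ a) {M : ℝ} (hM : 0 < M) (haN : (a : ℝ) * Real.exp M ≤ N) :
    ‖κ‖ ^ 2 * ‖ω.expect Λ O‖ ^ 2 ≤ β * ‖O‖ ^ 2 * (4 * ‖numberCharge 3‖ ^ 2 * (27 * (2 * ρ₀ + 1) *
      ((∑ X ∈ (thicken ({0} : Finset (Site 3)) 1).powerset with (0 : Site 3) ∈ X, ‖(stackedHubbardInteraction t t' tp U μ).Φ X‖) *
          (32 * (1 + Real.log ((N + ρ₀ + 1 : ℕ) : ℝ)) / M ^ 2) +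
        4 * |tp| * (2 * (N : ℝ) + 1) ^ 2))) := by
  have hmain := h.norm_sq_expect_le_layered (stackedHubbardInteraction_isTranslationInvariant t t' tp U μ)
    (stackedHubbardInteraction_hasFiniteRange t t' tp U μ) hβ (numberCharge_isHermitian 3) (parityAut_numberCharge 3)
    (commute_chargeSum_numberCharge_stacked t t' tp U μ) hΛ O (κ := κ) (by rw [chargeSum_numberCharge]; exact hO)
    (a := a) (N := N) (by rw [Nat.floor_one]; omega) hM haN
  rw [Nat.floor_one, card_box] at hmain
  have e27 : (((2 * 1 + 1) ^ 3 : ℕ) : ℝ) = 27 := by norm_num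
  rw [e27] at hmain
  simp only [Nat.cast_one, one_pow, mul_one] at hmain
  have hE := interlayerNorm_stacked_le t t' tp U μ 1
  refine hmain.trans ?_
  gcongr

/-- **THE PAIRING AMPLITUDE OF WEAKLY COUPLED HUBBARD LAYERS, any state with Bogoliubov rows**: for all orbitals `p, q` of a region
`Λ ⊆ box ρ₀` and all `a ≥ ρ₀ + 4`, `M > 0`, `N ≥ a e^M`,
`4|ω(c_p c_q)|² ≤ β · 4‖q‖² · 27(2ρ₀+1) · [S_Ψ · 32(1 + log(N + ρ₀ + 1))/M² + 4|t_⊥| (2N+1)²]`.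
[cite: KleinLandauShucker1981] [cite: KomaTasakiPRL1992, p. 3] -/
theorem InfVolFermionState.HasBogoliubovRows.norm_sq_expect_pair_le_stacked
    (h : ω.HasBogoliubovRows (stackedHubbardInteraction t t' tp U μ) 1 β)
    {Λ : Finset (Site 3)} {ρ₀ : ℕ} (hΛ : Λ ⊆ box 3 ρ₀) (p q : Orb (PolySite Λ))
    {a N : ℕ} (ha : ρ₀ + 4 ≤ a) {M : ℝ} (hM : 0 < M) (haN : (a : ℝ) * Real.exp M ≤ N) :
    4 * ‖ω.expect Λ (annihilation p * annihilation q)‖ ^ 2 ≤ β * (4 * ‖numberCharge 3‖ ^ 2 * (27 * (2 * ρ₀ + 1) *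
      ((∑ X ∈ (thicken ({0} : Finset (Site 3)) 1).powerset with (0 : Site 3) ∈ X, ‖(stackedHubbardInteraction t t' tp U μ).Φ X‖) *
          (32 * (1 + Real.log ((N + ρ₀ + 1 : ℕ) : ℝ)) / M ^ 2) +
        4 * |tp| * (2 * (N : ℝ) + 1) ^ 2))) := by
  have hmain := h.norm_sq_expect_le_stacked t t' tp U μ hβ hΛ (annihilation p * annihilation q)
    (totalNumber_commutator_annihilation_mul_annihilation p q) ha hM haN
  have hκ : ‖(-2 : ℂ)‖ ^ 2 = 4 := by norm_num
  rw [hκ] at hmain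
  have hO : ‖(annihilation p * annihilation q : FermionOp Λ)‖ ^ 2 ≤ 1 := by
    have h1 := (norm_mul_le (annihilation p : FermionOp Λ) (annihilation q)).trans
      (mul_le_one₀ (norm_annihilation_le_one p) (norm_nonneg _) (norm_annihilation_le_one q))
    exact pow_le_one₀ (norm_nonneg _) h1
  refine hmain.trans ?_
  have hC : 0 ≤ 4 * ‖numberCharge 3‖ ^ 2 * (27 * (2 * ρ₀ + 1) *
      ((∑ X ∈ (thicken ({0} : Finset (Site 3)) 1).powerset with (0 : Site 3) ∈ X, ‖(stackedHubbardInteraction t t' tp U μ).Φ X‖) *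
          (32 * (1 + Real.log ((N + ρ₀ + 1 : ℕ) : ℝ)) / M ^ 2) +
        4 * |tp| * (2 * (N : ℝ) + 1) ^ 2)) := by
    have hS0 : 0 ≤ ∑ X ∈ (thicken ({0} : Finset (Site 3)) 1).powerset with (0 : Site 3) ∈ X,
        ‖(stackedHubbardInteraction t t' tp U μ).Φ X‖ := Finset.sum_nonneg fun _ _ => norm_nonneg _
    have hlog : 0 ≤ 1 + Real.log ((N + ρ₀ + 1 : ℕ) : ℝ) :=
      add_nonneg zero_le_one (Real.log_nonneg (by exact_mod_cast Nat.succ_le_succ (Nat.zero_le _)))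
    positivity
  calc β * ‖(annihilation p * annihilation q : FermionOp Λ)‖ ^ 2 * _ ≤ β * 1 * _ :=
        mul_le_mul_of_nonneg_right (mul_le_mul_of_nonneg_left hO hβ) hC
    _ = _ := by rw [mul_one]

/-- **STRIPED / PERIODIC EQUILIBRIUM STATES OF WEAKLY COUPLED HUBBARD LAYERS HAVE THE SAME CEILING**: for every period `p`
and every `p`-periodic solution `ω` of the variational principle of the stacked `t–t'–t_⊥` Hubbard model at `β ≥ 0` (charge-,
spin- or pair-density-wave equilibrium states are of this kind), the pairing amplitude obeys
`4|ω(c_p c_q)|² ≤ β · 4‖q‖² · 27(2ρ₀+1) · [S_Ψ · 32(1 + log(N + ρ₀ + 1))/M² + 4|t_⊥| (2N+1)²]`.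
[cite: KleinLandauShucker1981] [cite: Israel1979, Thm. I.2.4] [cite: KomaTasakiPRL1992, p. 3] -/
theorem InfVolFermionState.IsPerVarEquilibrium.norm_sq_expect_pair_le_stacked {per : Fin 3 → ℕ}
    (h : ω.IsPerVarEquilibrium β per (stackedHubbardInteraction t t' tp U μ) 1)
    {Λ : Finset (Site 3)} {ρ₀ : ℕ} (hΛ : Λ ⊆ box 3 ρ₀) (p q : Orb (PolySite Λ))
    {a N : ℕ} (ha : ρ₀ + 4 ≤ a) {M : ℝ} (hM : 0 < M) (haN : (a : ℝ) * Real.exp M ≤ N) :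
    4 * ‖ω.expect Λ (annihilation p * annihilation q)‖ ^ 2 ≤ β * (4 * ‖numberCharge 3‖ ^ 2 * (27 * (2 * ρ₀ + 1) *
      ((∑ X ∈ (thicken ({0} : Finset (Site 3)) 1).powerset with (0 : Site 3) ∈ X, ‖(stackedHubbardInteraction t t' tp U μ).Φ X‖) *
          (32 * (1 + Real.log ((N + ρ₀ + 1 : ℕ) : ℝ)) / M ^ 2) +
        4 * |tp| * (2 * (N : ℝ) + 1) ^ 2))) :=
  (h.hasBogoliubovRows (by norm_num) (stackedHubbardInteraction_isHermitian t t' tp U μ)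
    (stackedHubbardInteraction_isEven t t' tp U μ) (stackedHubbardInteraction_isTranslationInvariant t t' tp U μ)
    (stackedHubbardInteraction_hasFiniteRange t t' tp U μ) hβ).norm_sq_expect_pair_le_stacked t t' tp U μ hβ hΛ p q ha hM haN

/-- **THE EXPLICIT `1/log(1/|t_⊥|)` LAW FOR THE PAIRING AMPLITUDE OF WEAKLY COUPLED HUBBARD LAYERS** (any state with Bogoliubov
rows; `0 < 4|t_⊥| < 1`, `ℓ = log(1/(4|t_⊥|))`, `a = ρ₀ + 5`):
`4|ω(c_p c_q)|² ≤ β · 4‖q‖² · 27(2ρ₀+1) · [S_Ψ (128/ℓ + 512(1 + log 3a)/ℓ²) + 50a²/ℓ]`: a pairing amplitude `m₀` at inverse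
temperature `β` forces `β ≥ m₀² · log(1/(4|t_⊥|)) / C(ρ₀, S_Ψ)` — a pairing amplitude of size `m₀` in weakly coupled Hubbard
layers lives only at temperatures `≤ C/(m₀² log(1/(4|t_⊥|)))`, uniformly in `t, t', U, μ` through `S_Ψ` only (a ceiling on the
order parameter, not on a critical temperature).
[cite: KleinLandauShucker1981] [cite: KomaTasakiPRL1992, p. 3] -/
theorem InfVolFermionState.HasBogoliubovRows.norm_sq_expect_pair_le_stacked_explicit
    (h : ω.HasBogoliubovRows (stackedHubbardInteraction t t' tp U μ) 1 β)
    {Λ : Finset (Site 3)} {ρ₀ : ℕ} (hΛ : Λ ⊆ box 3 ρ₀) (p q : Orb (PolySite Λ))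
    (htp0 : 0 < |tp|) (htp1 : 4 * |tp| < 1) :
    4 * ‖ω.expect Λ (annihilation p * annihilation q)‖ ^ 2 ≤ β * (4 * ‖numberCharge 3‖ ^ 2 * (27 * (2 * ρ₀ + 1) *
      ((∑ X ∈ (thicken ({0} : Finset (Site 3)) 1).powerset with (0 : Site 3) ∈ X, ‖(stackedHubbardInteraction t t' tp U μ).Φ X‖) *
          (128 / Real.log (1 / (4 * |tp|)) + 512 * (1 + Real.log (3 * (ρ₀ + 5 : ℕ))) / Real.log (1 / (4 * |tp|)) ^ 2) +
        50 * ((ρ₀ + 5 : ℕ) : ℝ) ^ 2 / Real.log (1 / (4 * |tp|))))) := by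
  set ε : ℝ := 4 * |tp| with hε_def
  have hε0 : 0 < ε := by positivity
  set a : ℕ := ρ₀ + 5 with ha_def
  have hℓ0 : 0 < Real.log (1 / ε) := Real.log_pos (by rw [lt_div_iff₀ hε0, one_mul]; exact htp1)
  have hM : 0 < Real.log (1 / ε) / 4 := by positivity
  have hmain := h.norm_sq_expect_pair_le_stacked t t' tp U μ hβ hΛ p q (a := a)
    (N := ⌈(a : ℝ) * Real.exp (Real.log (1 / ε) / 4)⌉₊) (by omega) hM (Nat.le_ceil _)
  have hS0 : 0 ≤ ∑ X ∈ (thicken ({0} : Finset (Site 3)) 1).powerset with (0 : Site 3) ∈ X,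
      ‖(stackedHubbardInteraction t t' tp U μ).Φ X‖ := Finset.sum_nonneg fun _ _ => norm_nonneg _
  have hbr := layeredBracket_explicit_le hε0 htp1 hS0 le_rfl (a := a) (r := 1) (ρ₀ := ρ₀) (by omega) (by omega) (by omega)
  simp only [Nat.cast_one, one_pow, mul_one] at hbr
  refine hmain.trans ?_
  have hρ : (0 : ℝ) ≤ 27 * (2 * ρ₀ + 1) := by positivity
  have := mul_le_mul_of_nonneg_left (mul_le_mul_of_nonneg_left hbr hρ) (by positivity : (0 : ℝ) ≤ 4 * ‖numberCharge 3‖ ^ 2)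
  have := mul_le_mul_of_nonneg_left this hβ
  refine this.trans (le_of_eq ?_)
  ring

end Stacked

end Literature.MathematicalPhysics.QuantumLattice

end
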